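import Literature.MathematicalPhysics.QuantumFieldTheory.Balaban1983to89.B8CubeMemberLevelSep
import Literature.MathematicalPhysics.QuantumFieldTheory.Balaban1983to89.B8TowerBondsPrinted
import Literature.MathematicalPhysics.QuantumFieldTheory.Balaban1983to89.B8SockB9P3ShellModeVacuityUniv

/-!
# `Balaban1983to89.B8TowerBondsLevelSep` — [Balaban1985RegularSpaces] (1.31) ∕ [Balaban1984PropagatorsII] (2.1)–(2.3) AT PRINT'S CLASS OF A GENERAL
# Λ-TOWER: THE AVERAGING-BINDER CLASS LAW `LevelSepPP L m Ω (fun m j => towerBondsP L Ω (Λs m) j) 1` («box ⊂ Ω_{j−1}, collar 1») FROM TWO DISPLAYED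
# INDEX LAWS — the unit collar (1.4) and the layer law (1.5) — the TOWER twin of n05-c g14's cube-member `B8CubeMemberLevelSep`

statement-level skeleton of published theorems with citation tags; proofs where landed; nothing here is a claim about the Yang–Mills mass gap

T. Bałaban, *Spaces of regular gauge field configurations on a lattice and gauge fixing conditions*, Commun. Math. Phys. **99** (1985) 75–102
`[Balaban1985RegularSpaces]` ("B8"; journal page = PDF page + 74): (1.3)–(1.6) p. 77 («Ω₀ ⊃ Ω₁ ⊃ … ⊃ Ω_k», «Ω_j = Bʲ(Ω_j^{(j)}) … (Lʲη)⁻¹dist(Ω_jᶜ, Ω_{j+1}) > RM₁»,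
«Λ_j = Ω_j^{(j)} ∖ Ω_{j+1}^{(j)}», «Ω = ⋃_j Bʲ(Λ_j)»), p. 77 (bond convention), (1.31) p. 82, (1.68) p. 88, (1.131) p. 99, p. 98.  T. Bałaban, *Propagators and
renormalization transformations for lattice gauge theories. II*, Commun. Math. Phys. **96** (1984) 223–250 `[Balaban1984PropagatorsII]` ("B6"), (2.1)–(2.3) p. 224.
T. Bałaban, *Propagators for lattice gauge theories in a background field*, Commun. Math. Phys. **99** (1985) 389–434 `[Balaban1985BackgroundPropagators]` ([4]),
(3.16) p. 393.

## WHY THIS FILE (cell `pub-ymgap`, HUMAN RULING D-0062 ∕ D-0149; DAG node N05 = [B8] (edge N06 → N05); width seat `pub-ymgap-dag-n05-w2` g2; proof lane, count-neutral)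

dag-n06-b g17's EDITION-P averaging binders `B9Eq316AveragingTransposeZdPrinted.avgAtP_withQQP` ∕ `avgAt_withQQP` ∕ `avgAtγ_withQQP` (p596576) discharge the
`AvgAt` ∕ `AvgAtγ` hypothesis of the b9-socket suppliers of N05's Prop.-3 frame for the GENUINE averaging letter `withQQP` — GIVEN the class law
`LevelSepPP L m Ω ΛbP s` of the class map they are fed: clause 1 «every box site of a level-`j` class bond lies in `Ω_{j−1}`», clause 2 «a unit bond at such a
site touches `Ω_{i'}` only for `i' ≤ j + s`».  At the CUBE member dag-n05-c g14 derived it (`B8CubeMemberLevelSep.levelSepPP_cubeLamBP'`, `s = 1`).  At PRINT'S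
CLASS OF A GENERAL Λ-TOWER — dag-n05-d's `B8TowerBondsPrinted.towerBondsP L Ω (Λs m)` (D0, p582555), the class the `Ω₀ = ℤᵈ` road and the P-carrier's `C137`
read — clause 1 is `towerBondsP_box_subset_pred` BY NAME, and clause 2 needs two index laws the typed `B8LeafModelZd.ZdIdx` does not carry (dag-n06-b, cell bus
2026-08-28 02:12Z, offer to the N05 width seats: «collar clause … from a DISPLAYED separation law of the member's Ω-tower — (1.28)∕[B6] (2.2): ℓ∞-1-neighbourhood
of Ω_{j+1} inside Ω_j AND Λ_j-blocks outside Ω_{j+1}; NOT among the typed `ZdIdx` laws»).  THIS FILE types that law lemma with the two laws DISPLAYED: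
* (L1) UNIT COLLAR «`BondTouches (Ω (j+1)) y μ → y ∈ Ω j`» — a site with a unit bond touching `Ω_{j+1}` lies in `Ω_j` (print (1.4): `(Lʲη)⁻¹dist(Ω_jᶜ, Ω_{j+1}) >
  RM₁ ≥ 1`);
* (L2) LAYER «for `j < m`, every site of the `j`-block of a point of `Λs m j` lies outside `Ω_{j+1}`» (print (1.5) with (1.4): `Λ_j = Ω_j^{(j)} ∖ Ω_{j+1}^{(j)}`,
  `Ω_{j+1}` a union of `j`-blocks; at `j = m` the truncated top `Λs m m` covers `Ω_m` ((1.68)) and nothing is asked).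
Both hold on print's nested tower `(T, □₁, …, □_k)` of (1.131) (§2, the A6 witnesses).

## WHAT IS PROVED (kernel, 0 sorry; theorems only, lattice bookkeeping)

* §1 ★★ `levelSepPP_towerBondsP` — nested `Ω`, any `Λs`, a truncation `m`, (L1) and (L2) at that `m` ⇒ `LevelSepPP L m Ω (fun m' j => towerBondsP L Ω (Λs m') j) 1`
  (`L ≥ 1`).  Proof: a box site `y` lies under an end of the bond (`B8IdxB8LawsB.under_or_of_bondBox`); if a unit bond at `y` touched `Ω_{i'}`, `i' ≥ j + 2`, then
  `y ∈ Ω_{j+1}` by (L1) — but `y` lies in a `j`-block of `Λs m j` (inner end, or the `Λ_j` end of a crossing bond; `j < m` is forced by `j + 2 ≤ i' ≤ m`) or in a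
  `(j−1)`-block of `Λs m (j−1)` (the other end of a crossing bond, through `B8Ineq166Univ.flm_under_of_under`), both outside `Ω_{j+1}` by (L2) and nesting.
  Member forms: `levelSepPP_towerBondsP_member` (`i : ZdIdx d L`, every `m ≤ i.k`) and `levelSepPP_towerBondsP_trunc` (dag-n06-b's junk-level recipe, bus
  02:21Z: the TRUNCATED class map `fun m' j => if m' ≤ i.k then towerBondsP … else ∅` obeys the law at EVERY `m'`, vacuously above `k`).
* §3 ★ `avgAtP_withQQP_towerBondsP` ∕ `avgAtP_withQQP_towerBondsP_trunc` ∕ `avgAtγ_withQQP_towerBondsP_trunc` — the GENUINE letter's averaging binders `AvgAtP` ∕ `AvgAtγ` AT PRINT'S CLASS of the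
  member's tower, BY NAME (n06-b's binders ∘ §1; γ currency at every truncation through the truncated class map).
* §4 `unitCollar_of_domainSeq` — (L1) FOLLOWS from the tree's TYPED (1.3)–(1.4) admissibility record `B8ConstraintBonds.DomainSeq L Ω` (`sep`: the
  `L^{j+1}`-ball about `Ω_{j+1}` lies in `Ω_j`); `levelSepPP_towerBondsP_of_domainSeq` (only (L2) stays displayed on admissible members);
  `unitCollar_cubeFam_true_of_domainSeq` (second road to §2's (L1) witness for `ρ ≥ L`, via `cubeFam_domainSeq`).
* §2 A6 — the laws are inhabited by print's tower: `unitCollar_cubeFam_true` ((L1) on `cubeFam true L a M ρ k` for `ρ ≥ 1`, via n05-c's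
  `B8CubeMemberLevelSep.mem_cube_of_add_unit_mem_cube_succ`); `exists_idxB8SubB_levelSepPP_towerBondsP_one` — the lawful top-cube member of the sub-index of
  record `IdxB8SubB θ` (n05-c's `exists_topCube_member_lawsB`: `Λs 1 0 = (□₁)ᶜ`, `Ω = (ℤᵈ, □₁, …)`) satisfies (L2) at truncation `m = 1`, hence the law there.

## HONEST SCOPE

Lattice geometry only (which domains `Ω_{i'}` a unit bond at a box site of a class bond can touch); NO estimate of [Balaban1985RegularSpaces] ∕ [4] is proved
or asserted; the two laws are DISPLAYED hypotheses (print's (1.4) ∕ (1.5), not typed `ZdIdx` laws); the binders' further inputs and the sockets' satisfiability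
at `m ≥ 1` ([4] Thm 3.3, N06 content) are untouched.  The A6 witness of §2 is at truncation `m = 1` (the faces `exists_topCube_member_lawsB` exports); the
cube tower at general `m` is n05-c's `levelSepPP_cubeLamBP'` (class `cubeLamBP'`), not re-derived here.  Count-neutral; N05 ∕ N06 NOT discharged; no count
claim (the chair's single count line is the only count); `T_η ↦ ℤᵈ`; one finite `𝕋⁴` programme at fixed `ε`, Bałaban AS PRINTED; the Yang–Mills mass gap
(Clay) is NOT proved by any of this — R4 closes the conditional finite-`𝕋⁴` rung `BalabanLadder.UV` only; nothing continuum ∕ ℝ⁴ ∕ OS.  No `sorry`, no `def`,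
no `instance`, no `notation`.  Unit `pub-ymgap-dag-n05-w2` (g2), 2026-08-28.

RELATED IN THE TREE, NOT DUPLICATED: `B8ConstraintBonds` (the typed (1.3)–(1.4) record `DomainSeq`, USED in §4), `B9Eq316AveragingTransposeZdPrinted` (n06-b g17: `LevelSepPP`, the binders, USED), `B8CubeMemberLevelSep` (n05-c g14: the cube
twin + the collar step, USED), `B8TowerBondsPrinted` (dag-n05-d D0: the class + its box law, USED), `B8TowerBondsNonempty` (`under_or_of_bondBox`, USED),
`B8SockB9P3ShellModeVacuityUniv` (n05-c: the lawful top-cube member, USED), `B8Prop7TowerAxialIneq145P` (this seat: the collar (1.145); its `collar_cubeFam_true`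
is the `j`-block-scale cousin of (L1)).

[cite: Balaban1985RegularSpaces, (1.3)–(1.6) p.77, p.77, (1.31) p.82, (1.68) p.88, (1.131) p.99, p.98; Balaban1984PropagatorsII, (2.1)–(2.3) p.224;
Balaban1985BackgroundPropagators, (3.16) p.393]
-/

noncomputable section

namespace Literature.MathematicalPhysics.QuantumFieldTheory.Balaban1983to89.B8TowerBondsLevelSep

open B7Prop1Explicit B7Prop1Local
open B8Ineq130 (tlo thi)
open B8Ineq132 (Under BondTouches)
open B8Thm2LogB (blockTop)
open B8Eq131Cubes (cube flm under_flm)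
open B8Eq131CubesAdmissible (cubeFam cubeFam_true_zero cubeFam_of_pos cubeFam_of_lt)
open B8Ineq166Univ (flm_under_of_under)
open B8IdxB8LawsB (under_or_of_bondBox IdxB8SubB)
open B8TowerBondsPrinted (towerBondsP towerBondsP_box_subset_pred)
open B9Eq316AveragingTransposeZdPrinted (LevelSepPP)
open B8CubeMemberLevelSep (mem_cube_of_add_unit_mem_cube_succ)
open B8SockB9P3ShellModeVacuityUniv (exists_topCube_member_lawsB)
open B8LeafModelZd (ZdIdx)
open B8ConstraintBonds (DomainSeq)
open B8Eq131CubesAdmissible (cubeFam_domainSeq)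

-- `Site` alone could resolve to the torus sites of `Setup.lean`; re-export the `ℤ^d` sites of `B7Prop1Explicit`.
export B7Prop1Explicit (Site)

variable {d : ℕ}

/-! ## §0 Plumbing: nesting, the `L`-block letter of the class, `BondTouches` monotone -/

section Plumbing

variable {L : ℕ}

/-- Nested regions are antitone in the level (private plumbing). [folklore] -/
private theorem subset_of_le {Ω : ℕ → Set (Site d)} (hΩ : ∀ j, Ω (j + 1) ⊆ Ω j) {a b : ℕ} (hab : a ≤ b) : Ω b ⊆ Ω a := by
  induction hab with
  | refl => exact le_rfl
  | step _ ih => exact (hΩ _).trans ih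

/-- `BondTouches` is monotone in the region (private plumbing). [folklore] -/
private theorem bondTouches_mono {S T : Set (Site d)} (hST : S ⊆ T) {y : Site d} {μ : Fin d} (h : BondTouches S y μ) : BondTouches T y μ := by
  rcases h with h | h
  · exact Or.inl (hST h)
  · exact Or.inr (hST h)

/-- `x ∈ B(q)` (`Under L 1 q x`) in the `L • q ≤ x ≤ L • q + blockTop L` letter of `ZdIdx.hclass` ∕ `towerBondsP` (private plumbing). [folklore] -/
private theorem smul_le_of_under_one {q x : Site d} (hx : Under L 1 q x) : (L : ℤ) • q ≤ x ∧ x ≤ (L : ℤ) • q + blockTop L := by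
  constructor
  · intro i
    have h := (hx i).1
    rw [pow_one] at h
    simpa [Pi.smul_apply, smul_eq_mul] using h
  · intro i
    have h := (hx i).2
    rw [pow_one] at h
    simp only [Pi.add_apply, Pi.smul_apply, smul_eq_mul, blockTop]
    linarith

/-- `Under L 0 z x` is `x = z` (private plumbing). [folklore] -/
private theorem eq_of_under_zero {z x : Site d} (hx : Under L 0 z x) : x = z := by
  funext i
  have h := hx i
  rw [pow_zero, one_mul, one_mul] at h
  omega

end Plumbing

/-! ## §1 The class law at print's class of a Λ-tower, from the unit collar (L1) and the layer law (L2) -/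

section Law

variable {L : ℕ}

/-- ★★ **THE AVERAGING-BINDER CLASS LAW AT PRINT'S CLASS OF A GENERAL Λ-TOWER**: for nested regions `Ω` (`Ω_{j+1} ⊆ Ω_j`), any restriction family `Λs`,
a truncation `m`, and `L ≥ 1`, IF (L1) «a site with a unit bond touching `Ω_{j+1}` lies in `Ω_j`» (print's (1.4) collar) and (L2) «for `j < m` the
`j`-blocks of the points of `Λs m j` avoid `Ω_{j+1}`» (print's (1.5) layers), THEN `LevelSepPP L m Ω (fun m' j => towerBondsP L Ω (Λs m') j) 1`: every box
site `y` of a level-`j` bond of print's class ((1.31): inner — both ends in `Λ_j`, box in `Ω_j`; crossing — one end in `Λ_j`, the `L`-block under the other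
in `Λ_{j−1}`, box in `Ω_{j−1}`) lies in `Ω_{j−1}` (clause 1 = `towerBondsP_box_subset_pred`) and a unit bond at `y` touches `Ω_{i'}` only for `i' ≤ j + 1`
(clause 2: else `y ∈ Ω_{j+1}` by (L1), while `y` lies in a `j`-block of `Λ_j` or a `(j−1)`-block of `Λ_{j−1}`, outside `Ω_{j+1}` by (L2) and nesting).
This is the hypothesis `hlaw` of dag-n06-b's `avgAtP_withQQP` ∕ `avgAt_withQQP` ∕ `avgAtγ_withQQP` at the class map `fun m j => towerBondsP L Ω (Λs m) j`.
[cite: Balaban1985RegularSpaces, (1.31) p.82, (1.3)–(1.5) p.77; Balaban1984PropagatorsII, (2.1)–(2.3) p.224; Balaban1985BackgroundPropagators, (3.16) p.393] -/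
theorem levelSepPP_towerBondsP (hL : 1 ≤ L) {Ω : ℕ → Set (Site d)} (hΩ : ∀ j, Ω (j + 1) ⊆ Ω j) (Λs : ℕ → ℕ → Set (Site d)) {m : ℕ}
    (hcolU : ∀ j, ∀ (y : Site d) (μ : Fin d), BondTouches (Ω (j + 1)) y μ → y ∈ Ω j)
    (hlay : ∀ j, j < m → ∀ z ∈ Λs m j, ∀ x, Under L j z x → x ∉ Ω (j + 1)) :
    LevelSepPP L m Ω (fun m' j => towerBondsP L Ω (Λs m') j) 1 := by
  intro j hj c hc y hy
  refine ⟨towerBondsP_box_subset_pred L hΩ (Λs m) hc y hy, ?_⟩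
  intro i' hi' μ htouch
  by_contra hgt
  have hi2 : j + 2 ≤ i' := by omega
  have hjm : j < m := by omega
  -- a unit bond at `y` touching `Ω_{i'} ⊆ Ω_{j+2}` puts `y` in `Ω_{j+1}` by the collar
  have hy1 : y ∈ Ω (j + 1) := hcolU (j + 1) y μ (bondTouches_mono (subset_of_le hΩ hi2) htouch)
  -- but `y` lies under an end of the bond, in a block of `Λ_j` or `Λ_{j−1}`, outside `Ω_{j+1}`
  rcases under_or_of_bondBox j c.1 c.2 hy with hu | hu
  · -- `y ∈ Bʲ(c₋)`
    rcases hc with ⟨-, h1, -⟩ | ⟨-, ⟨j', hjj', hblk, -⟩ | ⟨j', hjj', h1, -⟩⟩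
    · exact hlay j hjm c.1 h1 y hu hy1
    · -- crossing: the `L`-block under `c₋` lies in `Λ_{j'}`, `j = j' + 1`
      subst hjj'
      have h1 : Under L 1 c.1 (flm L j' y) := by
        have h := flm_under_of_under hL (j := j' + 1) (m := j') (by omega) hu
        rwa [Nat.add_sub_cancel_left] at h
      obtain ⟨hlo, hhi⟩ := smul_le_of_under_one h1
      have hmem : flm L j' y ∈ Λs m j' := hblk _ hlo hhi
      exact hlay j' (by omega) _ hmem y (under_flm hL j' y) ((hΩ (j' + 1)) hy1)
    · subst hjj'
      exact hlay (j' + 1) hjm c.1 h1 y hu hy1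
  · -- `y ∈ Bʲ(c₊)`
    rcases hc with ⟨-, -, h2⟩ | ⟨-, ⟨j', hjj', -, h2⟩ | ⟨j', hjj', -, hblk⟩⟩
    · exact hlay j hjm (c.1 + e c.2) h2 y hu hy1
    · subst hjj'
      exact hlay (j' + 1) hjm (c.1 + e c.2) h2 y hu hy1
    · -- mirrored crossing: the `L`-block under `c₊` lies in `Λ_{j'}`, `j = j' + 1`
      subst hjj'
      have h1 : Under L 1 (c.1 + e c.2) (flm L j' y) := by
        have h := flm_under_of_under hL (j := j' + 1) (m := j') (by omega) hu
        rwa [Nat.add_sub_cancel_left] at h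
      obtain ⟨hlo, hhi⟩ := smul_le_of_under_one h1
      have hmem : flm L j' y ∈ Λs m j' := hblk _ hlo hhi
      exact hlay j' (by omega) _ hmem y (under_flm hL j' y) ((hΩ (j' + 1)) hy1)

/-- **Member form**: at a member `i` of NODE 00's index whose Ω-tower obeys (L1) and whose restriction families obey (L2) at every truncation `m ≤ k`, the law
holds at every `m ≤ k` for the member-wise class map `fun m j => towerBondsP L i.Ω (i.Λs m) j` (nesting is the typed `ZdIdx.hΩ`).
[cite: Balaban1985RegularSpaces, (1.31) p.82, (1.3)–(1.5) p.77; Balaban1984PropagatorsII, (2.3) p.224] -/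
theorem levelSepPP_towerBondsP_member (hL : 1 ≤ L) (i : ZdIdx d L)
    (hcolU : ∀ j, ∀ (y : Site d) (μ : Fin d), BondTouches (i.Ω (j + 1)) y μ → y ∈ i.Ω j)
    (hlay : ∀ m, m ≤ i.k → ∀ j, j < m → ∀ z ∈ i.Λs m j, ∀ x, Under L j z x → x ∉ i.Ω (j + 1)) :
    ∀ m, m ≤ i.k → LevelSepPP L m i.Ω (fun m' j => towerBondsP L i.Ω (i.Λs m') j) 1 :=
  fun m hm => levelSepPP_towerBondsP hL i.hΩ i.Λs hcolU (hlay m hm)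

/-- **Truncated class map** (dag-n06-b's junk-level recipe): the class map `fun m' j => if m' ≤ k then towerBondsP … else ∅` obeys the law at EVERY truncation
`m'` — below `k` by `levelSepPP_towerBondsP`, above `k` vacuously (empty class) — so a supplier quantifying `∀ m` is fed with no guard.
[cite: Balaban1985RegularSpaces, (1.31) p.82, (1.68) p.88; Balaban1984PropagatorsII, (2.3) p.224] -/
theorem levelSepPP_towerBondsP_trunc (hL : 1 ≤ L) (i : ZdIdx d L)
    (hcolU : ∀ j, ∀ (y : Site d) (μ : Fin d), BondTouches (i.Ω (j + 1)) y μ → y ∈ i.Ω j)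
    (hlay : ∀ m, m ≤ i.k → ∀ j, j < m → ∀ z ∈ i.Λs m j, ∀ x, Under L j z x → x ∉ i.Ω (j + 1)) (m : ℕ) :
    LevelSepPP L m i.Ω (fun m' j => if m' ≤ i.k then towerBondsP L i.Ω (i.Λs m') j else ∅) 1 := by
  intro j hj c hc y hy
  dsimp only at hc
  by_cases hm : m ≤ i.k
  · rw [if_pos hm] at hc
    exact levelSepPP_towerBondsP hL i.hΩ i.Λs hcolU (hlay m hm) j hj c hc y hy
  · rw [if_neg hm] at hc
    exact absurd hc (Set.notMem_empty c)

end Law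

/-! ## §2 A6: print's nested tower `(T, □₁, …, □_k)` obeys the two laws -/

section Witness

variable {L : ℕ}

/-- **(L1) ON PRINT'S TOWER `(T, □₁, …, □_k)`** (`cubeFam true L a M ρ k`; `L, ρ ≥ 1`): a site with a unit bond touching `Ω_{j+1}` lies in `Ω_j` — `Ω_0 = ℤᵈ`;
for `1 ≤ j < k` the boundaries of `□_j ⊃ □_{j+1}` are `ρLʲ ≥ 1` fine sites apart (n05-c's `mem_cube_of_add_unit_mem_cube_succ`); `Ω_{j+1} = ∅` above `k`.
[cite: Balaban1985RegularSpaces, p.98 («□_j ⊃ □_{j+1} and a distance between boundaries of these cubes is equal to R₁M₁Lʲη»), (1.131) p.99, (1.4) p.77] -/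
theorem unitCollar_cubeFam_true (hL : 1 ≤ L) (a : Site d) (M : ℕ) {ρ : ℕ} (hρ : 1 ≤ ρ) (k : ℕ) :
    ∀ j, ∀ (y : Site d) (μ : Fin d), BondTouches (cubeFam true L a M ρ k (j + 1)) y μ → y ∈ cubeFam true L a M ρ k j := by
  intro j y μ h
  rcases Nat.lt_or_ge k (j + 1) with hk | hk
  · rw [cubeFam_of_lt true L a M ρ hk] at h
    rcases h with h | h <;> exact absurd h (Set.notMem_empty _)
  rcases Nat.eq_zero_or_pos j with rfl | hj
  · rw [cubeFam_true_zero]; exact Set.mem_univ y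
  have hjk : j < k := by omega
  rw [cubeFam_of_pos true L a M ρ (by omega) hk] at h
  rw [cubeFam_of_pos true L a M ρ hj hjk.le]
  rcases h with h | h
  · refine mem_cube_of_add_unit_mem_cube_succ hL a M hρ hjk (t := 0) (fun i => by simp) ?_
    rwa [add_zero]
  · refine mem_cube_of_add_unit_mem_cube_succ hL a M hρ hjk (t := e μ) (fun i => ?_) h
    rw [e_apply]; split_ifs <;> simp

/-- **A6: THE LAWFUL TOP-CUBE MEMBER OF THE SUB-INDEX OF RECORD OBEYS THE CLASS LAW AT TRUNCATION `m = 1`**: for every `θ` and every depth `k ≥ 1`, n05-c's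
member `j : IdxB8SubB θ` with `Ω = cubeFam true θ.L 0 1 θ.L k` (`η = L⁻ᵏ`, `a = 0`, `M = 1`, `ρ = L`; `exists_topCube_member_lawsB`) satisfies (L1) (previous
theorem, `ρ = L ≥ 1`) and (L2) at `m = 1` (its exported face `Λs 1 0 = (□₁)ᶜ`: the `0`-block of a point of `Λ′₀ = ℤᵈ ∖ □₁` is the point, outside `Ω_1 = □₁`),
hence `LevelSepPP θ.L 1 j.Ω (fun m j' => towerBondsP θ.L j.Ω (j.Λs m) j') 1` — the hypotheses of §1 are jointly inhabited by a genuinely nested lawful member.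
(General `m` at the cube tower: n05-c's `B8CubeMemberLevelSep.levelSepPP_cubeLamBP'`, class `cubeLamBP'`.)
[cite: Balaban1985RegularSpaces, (1.131) p.99 («Λ′₀ = T ∖ □₁»), (1.3)–(1.6) p.77, (1.31) p.82, p.98] -/
theorem exists_idxB8SubB_levelSepPP_towerBondsP_one (θ : Node00.Stage3Params) {k : ℕ} (hk : 1 ≤ k) :
    ∃ j : IdxB8SubB θ, j.1.1.k = k ∧ j.1.1.Ω = cubeFam true θ.L 0 1 θ.L k ∧
      LevelSepPP θ.L 1 j.1.1.Ω (fun m j' => towerBondsP θ.L j.1.1.Ω (j.1.1.Λs m) j') 1 := by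
  have hL : 1 ≤ θ.L := le_trans (by norm_num) θ.two_le_L
  have hL0 : (0 : ℝ) < θ.L := by exact_mod_cast (show 0 < θ.L by omega)
  have hη : (0 : ℝ) < ((θ.L : ℝ)⁻¹) ^ k := pow_pos (inv_pos.mpr hL0) k
  have hscale : (θ.L : ℝ) ^ k * ((θ.L : ℝ)⁻¹) ^ k ≤ 1 := by
    rw [← mul_pow, mul_inv_cancel₀ hL0.ne', one_pow]
  obtain ⟨i, hik, -, hΩ, hΛ0, -, -, hlaws⟩ :=
    exists_topCube_member_lawsB (d := θ.D) hL (0 : Site θ.D) 1 (le_refl θ.L) hk hη hscale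
  have hΩ0 : i.Ω 0 = Set.univ := by rw [hΩ]; exact cubeFam_true_zero θ.L 0 1 θ.L k
  refine ⟨⟨⟨i, hΩ0⟩, hlaws⟩, hik, hΩ, ?_⟩
  show LevelSepPP θ.L 1 i.Ω (fun m j' => towerBondsP θ.L i.Ω (i.Λs m) j') 1
  refine levelSepPP_towerBondsP hL i.hΩ i.Λs (fun j y μ h => ?_) (fun j hj z hz x hx => ?_)
  · rw [hΩ] at h ⊢
    exact unitCollar_cubeFam_true hL 0 1 hL k j y μ h
  · have hj0 : j = 0 := by omega
    subst hj0
    rw [hΛ0] at hz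
    rw [eq_of_under_zero hx, hΩ, zero_add, cubeFam_of_pos true θ.L 0 1 θ.L le_rfl hk]
    exact hz

end Witness

/-! ## §3 The edition-P averaging binders AT PRINT'S CLASS OF THE MEMBER'S TOWER, by name (dag-n06-b's `avgAtP_withQQP` ∕ `avgAtγ_withQQP` ∘ §1) -/

section Binder

variable {𝔸 : Type*} [CStarAlgebra 𝔸] (τ : 𝔸 →ₗ[ℂ] ℂ) [FiniteDimensional ℝ 𝔸] {L : ℕ} [Nontrivial 𝔸]

open B9SupplySockB9P3ZdLetters (OpsZd)
open B9SupplySockB9P3ZdGammaUniv (AvgAtP)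
open B9SupplySockB9P3ZdGamma (AvgAtγ)
open B9Eq316AveragingTransposeZd (qQ betaTau)
open B9Eq316AveragingTransposeZdPrinted (withQQP avgAtP_withQQP avgAtγ_withQQP)

/-- ★ **THE GENUINE AVERAGING LETTER'S `AvgAtP` BINDER AT PRINT'S CLASS `towerBondsP` OF THE MEMBER'S TOWER** (`d, L ≥ 2`; every truncation `m ≤ k`):
dag-n06-b's `avgAtP_withQQP` with its `hlaw` discharged by §1 under (L1) ∕ (L2) — constant `qQ d L C_τ β_τ 1`.
[cite: Balaban1985BackgroundPropagators, (3.16) p.393; Balaban1985RegularSpaces, (1.56), (1.58) p.86, (1.31) p.82, (1.4)–(1.5) p.77] -/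
theorem avgAtP_withQQP_towerBondsP (hd : 2 ≤ d) (hL : 2 ≤ L)
    {Cτ : ℝ} (hCτ : ∀ x y : 𝔸, |(τ (star x * y)).re| ≤ Cτ * ‖x‖ * ‖y‖)
    (ops₀ : ℝ → ZdIdx d L → ℕ → OpsZd d 𝔸) (M : ℝ) (i : ZdIdx d L)
    (hcolU : ∀ j, ∀ (y : Site d) (μ : Fin d), BondTouches (i.Ω (j + 1)) y μ → y ∈ i.Ω j)
    (hlay : ∀ m, m ≤ i.k → ∀ j, j < m → ∀ z ∈ i.Λs m j, ∀ x, Under L j z x → x ∉ i.Ω (j + 1))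
    {m : ℕ} (hm : m ≤ i.k) :
    AvgAtP L (withQQP τ L (fun m' j => towerBondsP L i.Ω (i.Λs m') j) ops₀) (qQ d L Cτ (betaTau τ) 1)
      (fun m' j => towerBondsP L i.Ω (i.Λs m') j) M i m :=
  avgAtP_withQQP τ L hd hL hCτ _ ops₀ M i m
    (levelSepPP_towerBondsP (le_trans one_le_two hL) i.hΩ i.Λs hcolU (hlay m hm))

/-- ★ **The `AvgAtP` binder AT EVERY truncation `m` through the TRUNCATED class map** (vacuous above `k`) — the shape `havg : ∀ M j m, AvgAtP L ops q (ΛbP j) M (ι j) m`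
of the univ-road suppliers `B9SupplySockB9P3ZdGammaUniv.sockB9P3P_allLevels_univ_explicit_on` ∕ `…srcHP…` asks for, member by member, with no guard on `m`.
[cite: Balaban1985BackgroundPropagators, (3.16) p.393; Balaban1985RegularSpaces, (1.56), (1.58) p.86, (1.31) p.82, (1.4)–(1.5) p.77, (1.68) p.88] -/
theorem avgAtP_withQQP_towerBondsP_trunc (hd : 2 ≤ d) (hL : 2 ≤ L)
    {Cτ : ℝ} (hCτ : ∀ x y : 𝔸, |(τ (star x * y)).re| ≤ Cτ * ‖x‖ * ‖y‖)
    (ops₀ : ℝ → ZdIdx d L → ℕ → OpsZd d 𝔸) (M : ℝ) (i : ZdIdx d L)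
    (hcolU : ∀ j, ∀ (y : Site d) (μ : Fin d), BondTouches (i.Ω (j + 1)) y μ → y ∈ i.Ω j)
    (hlay : ∀ m, m ≤ i.k → ∀ j, j < m → ∀ z ∈ i.Λs m j, ∀ x, Under L j z x → x ∉ i.Ω (j + 1)) (m : ℕ) :
    AvgAtP L (withQQP τ L (fun m' j => if m' ≤ i.k then towerBondsP L i.Ω (i.Λs m') j else ∅) ops₀) (qQ d L Cτ (betaTau τ) 1)
      (fun m' j => if m' ≤ i.k then towerBondsP L i.Ω (i.Λs m') j else ∅) M i m :=
  avgAtP_withQQP τ L hd hL hCτ _ ops₀ M i m (levelSepPP_towerBondsP_trunc (le_trans one_le_two hL) i hcolU hlay m)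

/-- ★ **The same in the γ currency** (`AvgAtγ`, the binder of the γ suppliers `sockB9P3D4γ(I)_at`), AT EVERY truncation `m` through the TRUNCATED class map
(vacuous above `k`): dag-n06-b's `avgAtγ_withQQP` ∘ `levelSepPP_towerBondsP_trunc` — feeds a `havg : ∀ M j m, AvgAtγ …` family with no guard.
[cite: Balaban1985BackgroundPropagators, (3.16) p.393; Balaban1985RegularSpaces, (1.56), (1.58) p.86, (1.31) p.82, (1.4)–(1.5) p.77, (1.68) p.88] -/
theorem avgAtγ_withQQP_towerBondsP_trunc (hd : 2 ≤ d) (hL : 2 ≤ L)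
    {Cτ : ℝ} (hCτ : ∀ x y : 𝔸, |(τ (star x * y)).re| ≤ Cτ * ‖x‖ * ‖y‖)
    (ops₀ : ℝ → ZdIdx d L → ℕ → OpsZd d 𝔸) (M : ℝ) (i : ZdIdx d L)
    (hcolU : ∀ j, ∀ (y : Site d) (μ : Fin d), BondTouches (i.Ω (j + 1)) y μ → y ∈ i.Ω j)
    (hlay : ∀ m, m ≤ i.k → ∀ j, j < m → ∀ z ∈ i.Λs m j, ∀ x, Under L j z x → x ∉ i.Ω (j + 1)) (m : ℕ) :
    AvgAtγ L (withQQP τ L (fun m' j => if m' ≤ i.k then towerBondsP L i.Ω (i.Λs m') j else ∅) ops₀) (qQ d L Cτ (betaTau τ) 1)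
      (fun m' j => if m' ≤ i.k then towerBondsP L i.Ω (i.Λs m') j else ∅) M i m :=
  avgAtγ_withQQP τ L hd hL hCτ _ ops₀ M i m (levelSepPP_towerBondsP_trunc (le_trans one_le_two hL) i hcolU hlay m)

end Binder

/-! ## §4 (L1) from the tree's TYPED (1.3)–(1.4) record `B8ConstraintBonds.DomainSeq` («Ω_j = Bʲ(Ω_j^{(j)}), (Lʲη)⁻¹dist(Ω_jᶜ, Ω_{j+1}) > RM₁») -/

section Admissible

variable {L : ℕ}

/-- **THE UNIT COLLAR (L1) IS A CONSEQUENCE OF PRINT'S ADMISSIBILITY (1.3)–(1.4) AS TYPED IN THE TREE** (`B8ConstraintBonds.DomainSeq L Ω`: `anti` (1.3),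
`sat` ∕ `sep` (1.4) — the `ℓ∞`-ball of radius `L^{j+1}` about a point of `Ω_{j+1}` lies in `Ω_j`): a site with a unit bond touching `Ω_{j+1}` lies in `Ω_j`
(`L ≥ 1`).  So (L1) is not an extra assumption on ADMISSIBLE members; print's cube tower is admissible for `ρ ≥ L` (`B8Eq131CubesAdmissible.cubeFam_domainSeq`).
[cite: Balaban1985RegularSpaces, (1.3)–(1.4) p.77] -/
theorem unitCollar_of_domainSeq (hL : 1 ≤ L) {Ω : ℕ → Set (Site d)} (h : DomainSeq L Ω) :
    ∀ j, ∀ (y : Site d) (μ : Fin d), BondTouches (Ω (j + 1)) y μ → y ∈ Ω j := by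
  intro j y μ hb
  rcases hb with hy | hy
  · exact h.anti j hy
  · have h1 : (1 : ℤ) ≤ (L : ℤ) ^ (j + 1) := one_le_pow₀ (by exact_mod_cast hL)
    have hs := h.sep j (y + e μ) (-(e μ)) hy (fun i => by
      rw [Pi.neg_apply, abs_neg, e_apply]
      split_ifs <;> simp [h1])
    rwa [add_neg_cancel_right] at hs

/-- ★ **THE CLASS LAW AT PRINT'S CLASS OF AN ADMISSIBLE Λ-TOWER**: `DomainSeq L Ω` ((1.3)–(1.4), typed) + the layer law (L2) at truncation `m` ⇒
`LevelSepPP L m Ω (fun m' j => towerBondsP L Ω (Λs m') j) 1` — §1 with (L1) discharged by `unitCollar_of_domainSeq`; only print's (1.5) reading of the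
restriction family («the `j`-blocks of `Λs m j`, `j < m`, avoid `Ω_{j+1}`») stays displayed.
[cite: Balaban1985RegularSpaces, (1.3)–(1.5) p.77, (1.31) p.82; Balaban1984PropagatorsII, (2.1)–(2.3) p.224] -/
theorem levelSepPP_towerBondsP_of_domainSeq (hL : 1 ≤ L) {Ω : ℕ → Set (Site d)} (h : DomainSeq L Ω) (Λs : ℕ → ℕ → Set (Site d)) {m : ℕ}
    (hlay : ∀ j, j < m → ∀ z ∈ Λs m j, ∀ x, Under L j z x → x ∉ Ω (j + 1)) :
    LevelSepPP L m Ω (fun m' j => towerBondsP L Ω (Λs m') j) 1 :=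
  levelSepPP_towerBondsP hL h.anti Λs (unitCollar_of_domainSeq hL h) hlay

/-- (L1) on print's tower `(T, □₁, …, □_k)` for `ρ ≥ L`, READ OFF ITS TYPED ADMISSIBILITY (`cubeFam_domainSeq`) — the `ρ ≥ L` case of `unitCollar_cubeFam_true`
by a second road. [cite: Balaban1985RegularSpaces, (1.3)–(1.4) p.77, p.98, (1.131) p.99] -/
theorem unitCollar_cubeFam_true_of_domainSeq (hL : 1 ≤ L) (a : Site d) (M : ℕ) {ρ : ℕ} (hρ : L ≤ ρ) (k : ℕ) :
    ∀ j, ∀ (y : Site d) (μ : Fin d), BondTouches (cubeFam true L a M ρ k (j + 1)) y μ → y ∈ cubeFam true L a M ρ k j :=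
  unitCollar_of_domainSeq hL (cubeFam_domainSeq true hL a M hρ k)

end Admissible

end Literature.MathematicalPhysics.QuantumFieldTheory.Balaban1983to89.B8TowerBondsLevelSep

end
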